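import Summits.Ventures.Crystal3D.Theorems.StickyWulffConstantGenericWallFloorResidualCoverageWith
import Summits.Ventures.Crystal3D.Theorems.StickyWulffConstantCoaxialWallLawLedgerWithCharge
import Summits.Ventures.Crystal3D.Theorems.StickyWulffConstantGenericWallFloorAffineSampleDeficit
import HarnessLib

/-!
# Restatement programme, GENERIC cone: the uniform closer in the deficiency-form currency `GenericWallFloorWithCharge`
# (`genericWallFloorWithCharge_all_of_coverage`, cf-p1 P5 (i) by name; crux `GenericWallFloor`, stmt-Ventures-19480, line `WallLedgerG`)

HONEST FRAMING. Venture `Summits/Ventures/Crystal3D` (cell `crystal3d-full`); helper `--supports` the crux `GenericWallFloor` and lane T's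
uniform port.  Rung credit only (census-free, standard axioms); F-C1 not moved; named inputs as in `…ResidualCoverageWith`.

* `affineSampleDeficit_lower_unif` — `stub_affineSampleDeficit` (the LOWER sample-deficit bound `D(P) ≥ 2φπρ² − Cρ`) with the
  constant in front of the pair: the constant of `sampleDeficit_offset_window` depends on the window height only (proof verbatim).
* `genericWallFloorWithCharge_of_ledgerWith_unif` — `TwoSlabLedgerWith C 10 c → GenericWallFloorWithCharge (|C| + K) 10 c`, one `K`
  (`genericWallFloorAtCharge_of_ledger` verbatim with the uniform lower bound).
* **`genericWallFloorWithCharge_all_of_coverage`** — `P5Exhaustion → StarPairFar → ResidualOneSidedCoverage c₀ → ∃ C, ∀` non-co-axial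
  pairs, `GenericWallFloorWithCharge C 10 c₀ A₁ t₁ A₂ t₂` (`0 < c₀ ≤ 1`): brick 1b's currency, from `twoSlabLedgerWith_all_of_coverage`.
* `residualOneSidedCoverage_of_forall_covered` — the certificate's stronger statement («every non-co-axial pair is
  `CoveredAtCharge c₀`», 19480-p1 g13 / cf-p1 (lxxviii)) implies the typed fact.
WHAT THIS IS NOT: a proof of `ResidualOneSidedCoverage c₀`; F-C1 not moved.
-/

noncomputable section

namespace Summit.Ventures.Crystal3D.Theorems

open Summit.Ventures.Crystal3D Finset
open Literature.MathematicalPhysics.StatisticalMechanics (fccStacking barlowStacking IsHaggSeq contactDeficiency)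
open scoped InnerProductSpace

/-! ### The deficiency-form currency `GenericWallFloorWithCharge` (brick 1b), uniformly -/

/-- **The LOWER sample-deficit bound with a constant uniform in the pair** (`stub_affineSampleDeficit` verbatim, the `∃ C`
moved in front of `A, t`: the constant of `sampleDeficit_offset_window` depends on the window height `R` only). -/
theorem affineSampleDeficit_lower_unif (R : ℝ) (hR : 1 ≤ R) : ∃ C : ℝ,
    ∀ (A : EuclideanSpace ℝ (Fin 3) ≃ₗᵢ[ℝ] EuclideanSpace ℝ (Fin 3)) (t : EuclideanSpace ℝ (Fin 3)),
      ∀ a b : ℝ, b - a = R → ∀ ρ : ℝ, R ≤ ρ →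
      ∀ P : Finset (EuclideanSpace ℝ (Fin 3)),
        (∀ p, p ∈ P ↔ (p ∈ (fun q => A q + t) '' fccStacking 1 (Real.sqrt (2 / 3)) ∧
          a ≤ p 2 ∧ p 2 ≤ b ∧ p 0 ^ 2 + p 1 ^ 2 ≤ ρ ^ 2)) →
        2 * (Real.sqrt 2 / 4 * ∑ᶠ w ∈ {w ∈ fccStacking 1 (Real.sqrt (2 / 3)) | ‖w‖ = 1},
            |⟪w, A.symm (EuclideanSpace.single (2 : Fin 3) (1 : ℝ))⟫_ℝ|) * Real.pi * ρ ^ 2 - C * ρ ≤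
          contactDeficiency P := by
  classical
  obtain ⟨C, hC⟩ := sampleDeficit_offset_window R hR
  refine ⟨C, ?_⟩
  intro A t a b hab ρ hρ P hP
  -- the pulled-back normal and offset
  set e₃ : EuclideanSpace ℝ (Fin 3) := EuclideanSpace.single (2 : Fin 3) (1 : ℝ) with he₃
  set ν : EuclideanSpace ℝ (Fin 3) := A.symm e₃ with hν
  set s : EuclideanSpace ℝ (Fin 3) := A.symm t with hs
  have he₃n : ‖e₃‖ = 1 := by
    rw [he₃, PiLp.norm_single, norm_one]
  have hνn : ‖ν‖ = 1 := by rw [hν, LinearIsometryEquiv.norm_map, he₃n]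
  have hAν : A ν = e₃ := by rw [hν, LinearIsometryEquiv.apply_symm_apply]
  have hAs : A s = t := by rw [hs, LinearIsometryEquiv.apply_symm_apply]
  -- the motion and its inverse
  set g : EuclideanSpace ℝ (Fin 3) → EuclideanSpace ℝ (Fin 3) := fun q => A q + t with hg
  set ginv : EuclideanSpace ℝ (Fin 3) → EuclideanSpace ℝ (Fin 3) := fun p => A.symm (p - t) with hginv
  have hg_ginv : ∀ p, g (ginv p) = p := by
    intro p; simp only [hg, hginv, LinearIsometryEquiv.apply_symm_apply]; abel
  have hginv_g : ∀ q, ginv (g q) = q := by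
    intro q; simp only [hg, hginv, add_sub_cancel_right, LinearIsometryEquiv.symm_apply_apply]
  have hginv_iso : Isometry ginv := by
    intro p q
    simp only [hginv, edist_dist, LinearIsometryEquiv.dist_map, dist_sub_right]
  have hgq : ∀ q, g q = A (q + s) := by
    intro q; simp only [hg, map_add, hAs]
  -- coordinates of `g q`
  have h2 : ∀ q, g q 2 = ⟪q + s, ν⟫_ℝ := by
    intro q
    have : g q 2 = ⟪g q, e₃⟫_ℝ := by
      rw [he₃, EuclideanSpace.inner_single_right]; simp
    rw [this, hgq, ← hAν, LinearIsometryEquiv.inner_map_map]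
  have hlat : ∀ q, g q 0 ^ 2 + g q 1 ^ 2 = ‖q + s‖ ^ 2 - ⟪q + s, ν⟫_ℝ ^ 2 := by
    intro q
    rw [sq_add_sq_eq_norm_sq_sub, ← he₃, hgq, LinearIsometryEquiv.norm_map, ← hAν,
      LinearIsometryEquiv.inner_map_map]
  -- the pulled-back sample
  set P' : Finset (EuclideanSpace ℝ (Fin 3)) := P.image ginv with hP'
  have hmemP' : ∀ q, q ∈ P' ↔ g q ∈ P := by
    intro q
    rw [hP', mem_image]
    constructor
    · rintro ⟨p, hp, rfl⟩
      rw [hg_ginv]; exact hp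
    · intro hq
      exact ⟨g q, hq, hginv_g q⟩
  have hP'iff : ∀ q, q ∈ P' ↔ (q ∈ fccStacking 1 (Real.sqrt (2 / 3)) ∧ a ≤ ⟪q + s, ν⟫_ℝ ∧
      ⟪q + s, ν⟫_ℝ ≤ a + R ∧ ‖q + s‖ ^ 2 - ⟪q + s, ν⟫_ℝ ^ 2 ≤ ρ ^ 2) := by
    intro q
    rw [hmemP', hP (g q), h2, hlat, ← hab, add_sub_cancel]
    have himg : g q ∈ (fun q => A q + t) '' fccStacking 1 (Real.sqrt (2 / 3)) ↔
        q ∈ fccStacking 1 (Real.sqrt (2 / 3)) := by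
      constructor
      · rintro ⟨q', hq', hqq'⟩
        have : q' = q := by
          have h1 : ginv (g q') = ginv (g q) := congrArg ginv hqq'
          rwa [hginv_g, hginv_g] at h1
        rw [← this]; exact hq'
      · intro hq
        exact ⟨q, hq, rfl⟩
    rw [himg]
  have hbound := hC ν hνn s a ρ hρ P' hP'iff
  have hDP : contactDeficiency P' = contactDeficiency P := by
    rw [hP', contactDeficiency_image_of_isometry hginv_iso]
  rw [hDP] at hbound
  exact hbound

open scoped Classical in
/-- **Ledger ⇒ deficiency form, uniformly** (`genericWallFloorAtCharge_of_ledger` with the uniform LOWER sample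
deficit `affineSampleDeficit_lower_unif`): one absolute `K` with `TwoSlabLedgerWith C 10 c → GenericWallFloorWithCharge (|C| + K) 10 c` for all
pairs, constants and charges. -/
theorem genericWallFloorWithCharge_of_ledgerWith_unif : ∃ K : ℝ, ∀ {C c : ℝ}
    {A₁ : EuclideanSpace ℝ (Fin 3) ≃ₗᵢ[ℝ] EuclideanSpace ℝ (Fin 3)} {t₁ : EuclideanSpace ℝ (Fin 3)}
    {A₂ : EuclideanSpace ℝ (Fin 3) ≃ₗᵢ[ℝ] EuclideanSpace ℝ (Fin 3)} {t₂ : EuclideanSpace ℝ (Fin 3)},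
    TwoSlabLedgerWith C 10 c A₁ t₁ A₂ t₂ → GenericWallFloorWithCharge (|C| + K) 10 c A₁ t₁ A₂ t₂ := by
  classical
  obtain ⟨Cl, hCl⟩ := affineSampleDeficit_lower_unif 10 (by norm_num)
  refine ⟨|Cl| + |Cl|, ?_⟩
  intro C c A₁ t₁ A₂ t₂ hadh
  have hC₁ := hCl A₁ t₁
  have hC₂ := hCl A₂ t₂
  intro h hh ρ hρ N x hx hcyl hslab₁ hslab₂
  -- the packing as a finite set, the two samples as filters
  have hxinj : Function.Injective x := hx.injective
  set X : Finset (EuclideanSpace ℝ (Fin 3)) := univ.image x with hX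
  set P₁ : Finset (EuclideanSpace ℝ (Fin 3)) := X.filter fun p =>
    p ∈ (fun q => A₁ q + t₁) '' fccStacking 1 (Real.sqrt (2 / 3)) ∧
      -(2 * 10) ≤ p 2 ∧ p 2 ≤ -10 ∧ p 0 ^ 2 + p 1 ^ 2 ≤ ρ ^ 2 with hP₁
  set P₂ : Finset (EuclideanSpace ℝ (Fin 3)) := (X \ P₁).filter fun p =>
    p ∈ (fun q => A₂ q + t₂) '' fccStacking 1 (Real.sqrt (2 / 3)) ∧
      h + 10 ≤ p 2 ∧ p 2 ≤ h + 2 * 10 ∧ p 0 ^ 2 + p 1 ^ 2 ≤ ρ ^ 2 with hP₂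
  have hXpack : ∀ p ∈ X, ∀ q ∈ X, p ≠ q → 1 ≤ dist p q := by
    intro p hp q hq hpq
    obtain ⟨i, -, rfl⟩ := mem_image.1 hp
    obtain ⟨j, -, rfl⟩ := mem_image.1 hq
    exact hx.one_le_dist fun hij => hpq (by rw [hij])
  have hP₁X : P₁ ⊆ X := filter_subset _ _
  have hP₂X : P₂ ⊆ X \ P₁ := filter_subset _ _
  have hXcyl : ∀ p ∈ X, -(2 * 10) ≤ p 2 ∧ p 2 ≤ h + 2 * 10 ∧ p 0 ^ 2 + p 1 ^ 2 ≤ ρ ^ 2 := by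
    intro p hp
    obtain ⟨i, -, rfl⟩ := mem_image.1 hp
    exact hcyl i
  have hP₁iff : ∀ p, p ∈ P₁ ↔ (p ∈ (fun q => A₁ q + t₁) '' fccStacking 1 (Real.sqrt (2 / 3)) ∧
      -(2 * 10) ≤ p 2 ∧ p 2 ≤ -10 ∧ p 0 ^ 2 + p 1 ^ 2 ≤ ρ ^ 2) := by
    intro p
    rw [hP₁, mem_filter]
    refine ⟨fun hp => hp.2, fun hp => ⟨?_, hp⟩⟩
    obtain ⟨i, hi⟩ := hslab₁ p hp.1 ⟨hp.2.1, hp.2.2.1, hp.2.2.2⟩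
    exact mem_image.2 ⟨i, mem_univ _, hi⟩
  have hP₂iff : ∀ p, p ∈ P₂ ↔ (p ∈ (fun q => A₂ q + t₂) '' fccStacking 1 (Real.sqrt (2 / 3)) ∧
      h + 10 ≤ p 2 ∧ p 2 ≤ h + 2 * 10 ∧ p 0 ^ 2 + p 1 ^ 2 ≤ ρ ^ 2) := by
    intro p
    rw [hP₂, mem_filter]
    refine ⟨fun hp => hp.2, fun hp => ⟨?_, hp⟩⟩
    obtain ⟨i, hi⟩ := hslab₂ p hp.1 ⟨hp.2.1, hp.2.2.1, hp.2.2.2⟩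
    rw [mem_sdiff]
    refine ⟨mem_image.2 ⟨i, mem_univ _, hi⟩, fun hp1 => ?_⟩
    have h1 := ((hP₁iff p).1 hp1).2.2.1
    have h2 := hp.2.1
    linarith
  -- the three inequalities and the two splits
  have hadh' := hadh h hh ρ hρ X P₁ P₂ hXpack hP₁X hP₂X hXcyl hP₁iff hP₂iff
  have hD₁ := hC₁ (-(2 * 10)) (-10) (by ring) ρ hρ P₁ hP₁iff
  have hD₂ := hC₂ (h + 10) (h + 2 * 10) (by ring) ρ hρ P₂ hP₂iff
  have hsplit₁ := contactDeficiency_sdiff_split hP₁X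
  have hsplit₂ := contactDeficiency_sdiff_split hP₂X
  have hDX : contactDeficiency X = 6 * (N : ℝ) - (numContacts x : ℝ) :=
    contactDeficiency_image_eq x hxinj
  rw [← hDX]
  have hρ0 : (0 : ℝ) ≤ ρ := by linarith
  have h1h : (0 : ℝ) ≤ (1 + h) * ρ := by positivity
  have ha : C * (1 + h) * ρ ≤ |C| * (1 + h) * ρ := by
    have h1 : 0 ≤ (|C| - C) * ((1 + h) * ρ) := mul_nonneg (by linarith only [le_abs_self C]) h1h
    linarith only [h1]
  have hb : Cl * ρ ≤ |Cl| * (1 + h) * ρ := by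
    have h1 : 0 ≤ (|Cl| - Cl) * ρ := mul_nonneg (by linarith only [le_abs_self Cl]) hρ0
    have h2 : 0 ≤ |Cl| * h * ρ := by positivity
    linarith only [h1, h2]
  linarith only [hadh', hD₁, hD₂, hsplit₁, hsplit₂, ha, hb]

/-- **THE UNIFORM LANE-G CLOSER in the deficiency-form currency of brick 1b** (`genericWallFloorWithCharge_all_of_coverage`, the name of
cf-p1's P5(i) order): `P5Exhaustion → StarPairFar → ResidualOneSidedCoverage c₀ → ∃ C, ∀` non-co-axial pairs,
`GenericWallFloorWithCharge C 10 c₀ A₁ t₁ A₂ t₂` (`0 < c₀ ≤ 1`). -/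
theorem genericWallFloorWithCharge_all_of_coverage (hE1 : P5Exhaustion) (hSP : StarPairFar)
    {c₀ : ℝ} (hc₀ : 0 < c₀) (hc₁ : c₀ ≤ 1) (hcov : ResidualOneSidedCoverage c₀) :
    ∃ C : ℝ, ∀ (A₁ : EuclideanSpace ℝ (Fin 3) ≃ₗᵢ[ℝ] EuclideanSpace ℝ (Fin 3)) (t₁ : EuclideanSpace ℝ (Fin 3))
      (A₂ : EuclideanSpace ℝ (Fin 3) ≃ₗᵢ[ℝ] EuclideanSpace ℝ (Fin 3)) (t₂ : EuclideanSpace ℝ (Fin 3)),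
      (¬ ∃ (L : EuclideanSpace ℝ (Fin 3) ≃ₗᵢ[ℝ] EuclideanSpace ℝ (Fin 3)) (s₁ s₂ : EuclideanSpace ℝ (Fin 3))
        (σ σ' : ℤ → ℤ), IsHaggSeq σ ∧ IsHaggSeq σ' ∧
        (fun p => A₁ p + t₁) '' fccStacking 1 (Real.sqrt (2 / 3)) ⊆
          (fun p => L p + s₁) '' barlowStacking 1 (Real.sqrt (2 / 3)) σ ∧
        (fun p => A₂ p + t₂) '' fccStacking 1 (Real.sqrt (2 / 3)) ⊆
          (fun p => L p + s₂) '' barlowStacking 1 (Real.sqrt (2 / 3)) σ') →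
      GenericWallFloorWithCharge C 10 c₀ A₁ t₁ A₂ t₂ := by
  obtain ⟨C, hC⟩ := twoSlabLedgerWith_all_of_coverage hE1 hSP hc₀ hc₁ hcov
  obtain ⟨K, hK⟩ := genericWallFloorWithCharge_of_ledgerWith_unif
  exact ⟨|C| + K, fun A₁ t₁ A₂ t₂ hnc => hK (hC A₁ t₁ A₂ t₂ hnc)⟩

/-- **The certificate's stronger statement implies the typed fact**: if EVERY non-co-axial frame pair is `CoveredAtCharge c₀` (what the
exact engine of 19480-p1 g13 certifies, cf-p1 (lxxviii)), then `ResidualOneSidedCoverage c₀`. -/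
theorem residualOneSidedCoverage_of_forall_covered {c₀ : ℝ}
    (h : ∀ (A₁ A₂ : EuclideanSpace ℝ (Fin 3) ≃ₗᵢ[ℝ] EuclideanSpace ℝ (Fin 3)),
      (¬ ∃ (L : EuclideanSpace ℝ (Fin 3) ≃ₗᵢ[ℝ] EuclideanSpace ℝ (Fin 3)) (s₁ s₂ : EuclideanSpace ℝ (Fin 3))
        (σ σ' : ℤ → ℤ), IsHaggSeq σ ∧ IsHaggSeq σ' ∧
        A₁ '' fccStacking 1 (Real.sqrt (2 / 3)) ⊆ (fun p => L p + s₁) '' barlowStacking 1 (Real.sqrt (2 / 3)) σ ∧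
        A₂ '' fccStacking 1 (Real.sqrt (2 / 3)) ⊆ (fun p => L p + s₂) '' barlowStacking 1 (Real.sqrt (2 / 3)) σ') →
      CoveredAtCharge c₀ A₁ A₂) :
    ResidualOneSidedCoverage c₀ :=
  fun A₁ A₂ hnc _ _ _ _ _ _ _ _ => h A₁ A₂ hnc

end Summit.Ventures.Crystal3D.Theorems

end
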